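import Literature.NumberTheory.Sieve.Polymath8aDiscrepancy
import Literature.Barriers.Parity.SiegelZeroDichotomyPairHLSmoothSampling
import HarnessLib

/-!
# Polymath 8a, Lemma 3.4 (iii), smooth case: the Siegel–Walfisz property of a smooth sequence

Support file for the named fact `Literature.NumberTheory.Sieve.mpz_of_lt` (**parity.S29**,
`ParityWave0.lean`): D. H. J. Polymath, *New equidistribution estimates of Zhang type*, Algebra &
Number Theory 8:9 (2014) 2067–2199 = arXiv:1402.0811.  In the proof of Lemma 2.7 (§3), Lemma 3.4 (iii)
supplies the Siegel–Walfisz property (Definition 2.5 (ii):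
`|Δ(α 1_{(·,r)=1}; a (q))| ≪ τ(qr)^{O(1)} N log^{-A} x` for all `q, r ≥ 1`, every fixed `A` and every
primitive `a (q)`) of the pieces `α_k` of the Heath-Brown decomposition; "For `k > j`, `α_k` is
smooth, and the Siegel–Walfisz property for `α_k` follows from the Poisson summation formula (and
the rapid decay of the Fourier transform of smooth, compactly supported functions …)".  This file
PROVES that smooth case in explicit, uniform form (the general case — inheritance under Dirichlet
convolution — is `Polymath8a.abs_apDiscrepancy_coprime_mul_le` in `Polymath8aDiscrepancy.lean`, and
the Möbius pieces are served by the tree's `LFunctions.SiegelWalfiszMoebius_holds`):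

* `sum_filter_intModEq_eq_tsum` — sampling along the lattice `r + Lℤ` (integer form of the tree's
  `TaoTeravainen.sum_filter_modEq_eq_tsum`: only the values at integers matter);
* `sum_filter_coprime_eq_sum_divisors_moebius` — Möbius inversion of the constraint `(n, r) = 1`;
  `sum_filter_dvd_eq_sum_div`, `natCast_mul_eq_iff_of_isUnit`, `natCast_mul_ne_of_not_isUnit` —
  multiples of `d` in a window and in a residue class;
* `abs_apDiscrepancy_le_of_unit_classSum` — `|Δ(β; a (q))| ≤ 2E` as soon as the *primitive* class
  sums of `β` are within `E` of a common value;
* `abs_classSum_multiples_sub_le` — Poisson summation along the multiples of `d`: for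
  `g ∈ C_c^∞(ℝ)` vanishing outside `(1/2, X + 1/2)`,
  `|∑_{m ≤ X/d, m ≡ c (q)} g(dm) − Re ∫g/(qd)| ≤ (qd/12) ∫|g''|` (the tree's
  `TaoTeravainen.norm_tsum_sub_div_integral_le` for `g(d·)`);
* `abs_apDiscrepancy_coprime_smooth_le` — **the smooth case of Lemma 3.4 (iii)**: for `α = g` on
  `[1, X]`, `q, r ≥ 1`, `a (q)` primitive,
  `|Δ(α 1_{(·,r)=1}; a (q))| ≤ (q/6) ∫|g''| · ∑_{d ∣ r, d ≤ X} d ≤ (q X τ(r)/6) ∫|g''|`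
  (`sum_divisors_filter_le_mul_card`); with `g = ψ_N`, `∫|g''| ≍ N^{-1}` up to logarithms and
  `X ≍ N`, this is `≪ q τ(r) log^{O(1)} x`, i.e. the Siegel–Walfisz bound in the range
  `q ≤ N log^{-A-O(1)} x`, the remaining range being trivial.

The asymptotic bookkeeping (`⪅`, the choice of `A`) is not performed here.  Nothing in this file
discharges `mpz_of_lt`.

## References

* D. H. J. Polymath, *New equidistribution estimates of Zhang type*, Algebra & Number Theory 8:9
  (2014), 2067–2199, arXiv:1402.0811: Definition 2.5 (ii), Lemma 3.4 (iii) and its proof (§3).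
  [cite: Polymath8a2014]
* T. Tao, J. Teräväinen, J. London Math. Soc. 106 (2022), proof of Prop. 7.1 (the Poisson-summation
  sampling lemma of `SiegelZeroDichotomyPairHLSmoothSampling.lean`). [cite: TaoTeravainen2021]
-/

open Finset MeasureTheory
open scoped ContDiff ArithmeticFunction.Moebius

namespace Literature.NumberTheory.Sieve

namespace Polymath8a

/-- Sampling along a lattice, integer form of the tree's `TaoTeravainen.sum_filter_modEq_eq_tsum`:
if `g` vanishes at every integer `≤ 0` and at every integer `> N`, then for `L ≥ 1` the sum of `g`
over `1 ≤ n ≤ N`, `n ≡ r (mod L)`, is the full lattice sum `∑_{k ∈ ℤ} g(r + Lk)` (only the values of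
`g` at integers matter). [folklore] -/
theorem sum_filter_intModEq_eq_tsum {g : ℝ → ℂ} {N L : ℕ} (hL : 0 < L) (r : ℤ)
    (hg₁ : ∀ n : ℤ, n ≤ 0 → g n = 0) (hg₂ : ∀ n : ℤ, (N : ℤ) < n → g n = 0) :
    ∑ n ∈ (Icc 1 N).filter (fun n : ℕ => (n : ℤ) ≡ r [ZMOD L]), g n =
      ∑' k : ℤ, g (r + (L : ℝ) * k) := by
  classical
  set S : Finset ℤ := ((Icc 1 N).filter (fun n : ℕ => (n : ℤ) ≡ r [ZMOD L])).image
    (fun n : ℕ => ((n : ℤ) - r) / L) with hS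
  have hL0 : (L : ℤ) ≠ 0 := by exact_mod_cast hL.ne'
  have hkey : ∀ n : ℕ, (n : ℤ) ≡ r [ZMOD L] → r + (L : ℤ) * (((n : ℤ) - r) / L) = n := by
    intro n hn
    rw [Int.mul_ediv_cancel' (Int.ModEq.dvd hn.symm)]
    ring
  rw [tsum_eq_sum (s := S) ?_]
  · rw [hS, Finset.sum_image]
    · refine Finset.sum_congr rfl fun n hn => ?_
      rw [Finset.mem_filter] at hn
      congr 1
      exact_mod_cast (hkey n hn.2).symm
    · intro n hn n' hn' h
      rw [Finset.coe_filter, Set.mem_setOf_eq] at hn hn'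
      have h1 := hkey n hn.2
      have h2 := hkey n' hn'.2
      simp only at h
      rw [h] at h1
      exact_mod_cast h1.symm.trans h2
  · intro k hk
    by_contra hne
    apply hk
    -- the integer `m = r + L k` has `g m ≠ 0`, so `1 ≤ m ≤ N`
    set m : ℤ := r + L * k with hm
    have hgm : g (r + (L : ℝ) * k) = g (m : ℝ) := by rw [hm]; push_cast; ring_nf
    rw [hgm] at hne
    have h1 : 1 ≤ m := by
      by_contra h; exact hne (hg₁ m (by omega))
    have h2 : m ≤ N := by
      by_contra h; exact hne (hg₂ m (by omega))
    obtain ⟨n, hn⟩ : ∃ n : ℕ, (n : ℤ) = m := ⟨m.toNat, Int.toNat_of_nonneg (by omega)⟩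
    rw [hS, Finset.mem_image]
    refine ⟨n, ?_, ?_⟩
    · rw [Finset.mem_filter, Finset.mem_Icc]
      refine ⟨⟨by exact_mod_cast hn ▸ h1, by exact_mod_cast hn ▸ h2⟩, ?_⟩
      rw [hn, hm, Int.ModEq, Int.add_mul_emod_self_left]
    · rw [hn, hm, add_sub_cancel_left, Int.mul_ediv_cancel_left _ hL0]

/-- `∑_{d ∣ n} μ(d) = [n = 1]` over `ℝ` (Mathlib's `μ ⋆ ζ = 1`). [folklore] -/
theorem sum_divisors_moebius_eq (n : ℕ) :
    ∑ d ∈ n.divisors, (μ d : ℝ) = if n = 1 then 1 else 0 := by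
  have h := congrArg (fun f : ArithmeticFunction ℝ => f n)
    (ArithmeticFunction.coe_moebius_mul_coe_zeta (R := ℝ))
  simp only [ArithmeticFunction.coe_mul_zeta_apply, ArithmeticFunction.intCoe_apply,
    ArithmeticFunction.one_apply] at h
  exact h

/-- Möbius inversion of the coprimality constraint: for `r ≠ 0`,
`∑_{n ∈ s, (n, r) = 1} f(n) = ∑_{d ∣ r} μ(d) ∑_{n ∈ s, d ∣ n} f(n)`. [folklore] -/
theorem sum_filter_coprime_eq_sum_divisors_moebius (s : Finset ℕ) (f : ℕ → ℝ) {r : ℕ} (hr : r ≠ 0) :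
    ∑ n ∈ s with Nat.Coprime n r, f n =
      ∑ d ∈ r.divisors, (μ d : ℝ) * ∑ n ∈ s with d ∣ n, f n := by
  classical
  have hind : ∀ n : ℕ, (if Nat.Coprime n r then f n else 0) =
      ∑ d ∈ r.divisors, if d ∣ n then (μ d : ℝ) * f n else 0 := by
    intro n
    have hset : r.divisors.filter (fun d => d ∣ n) = (Nat.gcd n r).divisors := by
      ext d
      simp only [Finset.mem_filter, Nat.mem_divisors, Nat.dvd_gcd_iff]
      constructor
      · rintro ⟨⟨h1, -⟩, h2⟩; exact ⟨⟨h2, h1⟩, fun h => hr (Nat.eq_zero_of_gcd_eq_zero_right h)⟩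
      · rintro ⟨⟨h2, h1⟩, -⟩; exact ⟨⟨h1, hr⟩, h2⟩
    rw [← Finset.sum_filter, hset, ← Finset.sum_mul, sum_divisors_moebius_eq]
    simp [Nat.Coprime]
  rw [Finset.sum_filter, Finset.sum_congr rfl fun n _ => hind n, Finset.sum_comm]
  refine Finset.sum_congr rfl fun d _ => ?_
  rw [Finset.sum_filter, Finset.mul_sum]
  refine Finset.sum_congr rfl fun n _ => ?_
  split_ifs <;> simp

/-- If the class sums of `β` over the *primitive* classes `c (q)` are all within `E` of a common
value `m`, then `|Δ(β; a (q))| ≤ 2E` for every primitive `a` (the coprime mean is the average of the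
primitive class sums; non-primitive classes do not enter).  Variant of
`abs_apDiscrepancy_le_of_classSum`. [cite: Polymath8a2014, §3, proof of Lemma 2.7 (Type 0 case)] -/
theorem abs_apDiscrepancy_le_of_unit_classSum {q : ℕ} [NeZero q] (β : ℕ → ℝ) (X : ℕ) {m E : ℝ}
    (hE : ∀ u : (ZMod q)ˣ, |∑ n ∈ Icc 1 X with ((n : ℕ) : ZMod q) = u, β n - m| ≤ E)
    (a : (ZMod q)ˣ) : |apDiscrepancy β X q a| ≤ 2 * E := by
  classical
  have hφ : (0 : ℝ) < q.totient := by exact_mod_cast Nat.totient_pos.mpr (NeZero.pos q)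
  have hcard : (Finset.univ : Finset (ZMod q)ˣ).card = q.totient := by
    rw [Finset.card_univ, ZMod.card_units_eq_totient]
  have hmean : |(∑ n ∈ Icc 1 X with Nat.Coprime n q, β n) / (q.totient : ℝ) - m| ≤ E := by
    rw [sum_filter_coprime_eq_sum_units]
    have hrw : (∑ u : (ZMod q)ˣ, ∑ d ∈ Icc 1 X with ((d : ℕ) : ZMod q) = u, β d) / (q.totient : ℝ)
        - m = (∑ u : (ZMod q)ˣ, (∑ d ∈ Icc 1 X with ((d : ℕ) : ZMod q) = u, β d - m)) /
          (q.totient : ℝ) := by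
      rw [Finset.sum_sub_distrib, Finset.sum_const, hcard, nsmul_eq_mul]
      field_simp
    rw [hrw, abs_div, Nat.abs_cast, div_le_iff₀ hφ]
    calc |∑ u : (ZMod q)ˣ, (∑ d ∈ Icc 1 X with ((d : ℕ) : ZMod q) = u, β d - m)|
        ≤ ∑ u : (ZMod q)ˣ, |∑ d ∈ Icc 1 X with ((d : ℕ) : ZMod q) = u, β d - m| :=
          Finset.abs_sum_le_sum_abs _ _
      _ ≤ ∑ _u : (ZMod q)ˣ, E := Finset.sum_le_sum fun u _ => hE u
      _ = E * q.totient := by rw [Finset.sum_const, hcard, nsmul_eq_mul, mul_comm]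
  rw [apDiscrepancy]
  have key : ∀ S M : ℝ, |S - m| ≤ E → |M - m| ≤ E → |S - M| ≤ 2 * E := fun S M hS hM => by
    calc |S - M| = |(S - m) - (M - m)| := by ring_nf
      _ ≤ |S - m| + |M - m| := abs_sub _ _
      _ ≤ E + E := add_le_add hS hM
      _ = 2 * E := by ring
  exact key _ _ (hE a) hmean

section Multiples

variable {q : ℕ}

/-- Multiples of `d ≥ 1` in a filtered window: `∑_{n ≤ X, P(n), d ∣ n} f(n) = ∑_{m ≤ X/d, P(dm)} f(dm)`.
[folklore] -/
theorem sum_filter_dvd_eq_sum_div (P : ℕ → Prop) [DecidablePred P] (f : ℕ → ℝ) (X : ℕ) {d : ℕ}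
    (hd : 0 < d) :
    ∑ n ∈ ((Icc 1 X).filter P).filter (fun n => d ∣ n), f n =
      ∑ m ∈ (Icc 1 (X / d)).filter (fun m => P (d * m)), f (d * m) := by
  classical
  have hset : ((Icc 1 X).filter P).filter (fun n => d ∣ n) =
      ((Icc 1 (X / d)).filter (fun m => P (d * m))).image (fun m => d * m) := by
    ext n
    simp only [Finset.mem_filter, Finset.mem_Icc, Finset.mem_image]
    constructor
    · rintro ⟨⟨⟨h1, h2⟩, hP⟩, ⟨m, rfl⟩⟩
      refine ⟨m, ⟨⟨?_, ?_⟩, hP⟩, rfl⟩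
      · rcases Nat.eq_zero_or_pos m with h | h
        · subst h; simp at h1
        · exact h
      · exact (Nat.le_div_iff_mul_le hd).mpr (by rwa [mul_comm] at h2)
    · rintro ⟨m, ⟨⟨h1, h2⟩, hP⟩, rfl⟩
      refine ⟨⟨⟨Nat.mul_pos hd h1, ?_⟩, hP⟩, dvd_mul_right d m⟩
      have := (Nat.le_div_iff_mul_le hd).mp h2
      rwa [mul_comm] at this
  rw [hset, Finset.sum_image]
  intro m _ m' _ h
  exact Nat.eq_of_mul_eq_mul_left hd h

/-- The residue condition on multiples: for `d` invertible modulo `q`,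
`(dm ≡ b) ⟺ (m ≡ d⁻¹ b)`; for `d` not invertible and `b` primitive there are no solutions. [folklore] -/
theorem natCast_mul_eq_iff_of_isUnit {d : ℕ} (u : (ZMod q)ˣ) (hu : (u : ZMod q) = ((d : ℕ) : ZMod q))
    (b : ZMod q) (m : ℕ) :
    ((d * m : ℕ) : ZMod q) = b ↔ ((m : ℕ) : ZMod q) = ((u⁻¹ : (ZMod q)ˣ) : ZMod q) * b := by
  rw [Nat.cast_mul, ← hu]
  exact (Units.eq_inv_mul_iff_mul_eq u).symm

/-- For `b` primitive and `d` sharing a factor with `q`, no multiple of `d` lies in the class `b`.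
[folklore] -/
theorem natCast_mul_ne_of_not_isUnit {d : ℕ} (hd : ¬IsUnit ((d : ℕ) : ZMod q)) (b : (ZMod q)ˣ)
    (m : ℕ) : ((d * m : ℕ) : ZMod q) ≠ b := by
  intro h
  rw [Nat.cast_mul] at h
  exact hd (isUnit_of_mul_isUnit_left (h ▸ Units.isUnit b))

end Multiples

section Poisson

/-- **Poisson summation along the multiples of `d`** (the smooth case of Lemma 3.4 (iii) of
Polymath 8a: "For `k > j`, `α_k` is smooth, and the Siegel–Walfisz property for `α_k` follows from the
Poisson summation formula"): if `g ∈ C_c^∞(ℝ)` vanishes outside `(1/2, X + 1/2)` and `α(n) = g(n)` on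
`[1, X]`, then for `d, q ≥ 1` and every class `c (q)`,
`|∑_{m ≤ X/d, m ≡ c (q)} α(dm) − Re ∫g/(qd)| ≤ (q d/12) ∫|g''|` — the tree's
`TaoTeravainen.norm_tsum_sub_div_integral_le` for `y ↦ g(dy)` on the lattice `c + qℤ`, with
`∫ g(d·) = d⁻¹ ∫ g` and `∫ |(g(d·))''| = d ∫ |g''|`. [cite: Polymath8a2014, Lemma 3.4 (iii) (proof, smooth case)] -/
theorem abs_classSum_multiples_sub_le {g : ℝ → ℂ} (hg : ContDiff ℝ ∞ g) (hs : HasCompactSupport g)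
    {X : ℕ} (hg₁ : ∀ y : ℝ, y ≤ 1 / 2 → g y = 0) (hg₂ : ∀ y : ℝ, (X : ℝ) + 1 / 2 ≤ y → g y = 0)
    {α : ℕ → ℝ} (hα : ∀ n ∈ Icc 1 X, (α n : ℂ) = g n) {d : ℕ} (hd : 0 < d) {q : ℕ} (hq : 0 < q)
    (c : ZMod q) :
    |∑ m ∈ Icc 1 (X / d) with ((m : ℕ) : ZMod q) = c, α (d * m) -
        (∫ y, g y).re / ((q : ℝ) * d)| ≤ (q : ℝ) * d / 12 * ∫ y, ‖iteratedDeriv 2 g y‖ := by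
  classical
  haveI : NeZero q := ⟨hq.ne'⟩
  have hd0 : (d : ℝ) ≠ 0 := by exact_mod_cast hd.ne'
  -- the rescaled function
  set gd : ℝ → ℂ := fun y => g (d * y) with hgd
  have hgd_diff : ContDiff ℝ ∞ gd := hg.comp (contDiff_const.mul contDiff_id)
  have hgd_supp : HasCompactSupport gd := by
    have := hs.comp_smul hd0
    simpa only [smul_eq_mul] using this
  -- vanishing at the integers outside `[1, X/d]`
  have hgd₁ : ∀ n : ℤ, n ≤ 0 → gd n = 0 := fun n hn => by
    rw [hgd]
    refine hg₁ _ ?_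
    have : (n : ℝ) ≤ 0 := by exact_mod_cast hn
    have : (d : ℝ) * n ≤ 0 := mul_nonpos_of_nonneg_of_nonpos (Nat.cast_nonneg d) this
    linarith
  have hgd₂ : ∀ n : ℤ, ((X / d : ℕ) : ℤ) < n → gd n = 0 := fun n hn => by
    rw [hgd]
    refine hg₂ _ ?_
    have h1 : (X : ℤ) < (d : ℤ) * n := by
      have h2 : (X : ℤ) < ((X / d : ℕ) : ℤ) * d + d := by exact_mod_cast Nat.lt_div_mul_add hd
      have h4 : (d : ℤ) * (((X / d : ℕ) : ℤ) + 1) ≤ (d : ℤ) * n :=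
        mul_le_mul_of_nonneg_left (by omega) (by positivity)
      linarith
    have h5 : (X : ℤ) + 1 ≤ (d : ℤ) * n := h1
    have h6 : ((X : ℤ) : ℝ) + 1 ≤ ((d : ℤ) : ℝ) * ((n : ℤ) : ℝ) := by exact_mod_cast h5
    push_cast at h6
    linarith
  -- the class `c` as integers `≡ c.val (mod q)`
  set r : ℤ := (c.val : ℤ) with hr
  have hclass : ∀ m : ℕ, ((m : ℕ) : ZMod q) = c ↔ (m : ℤ) ≡ r [ZMOD q] := fun m => by
    rw [hr, Int.ModEq, ← ZMod.intCast_eq_intCast_iff', Int.cast_natCast, Int.cast_natCast,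
      ZMod.natCast_zmod_val]
  have hfilter : (Icc 1 (X / d)).filter (fun m : ℕ => ((m : ℕ) : ZMod q) = c) =
      (Icc 1 (X / d)).filter (fun m : ℕ => (m : ℤ) ≡ r [ZMOD q]) :=
    Finset.filter_congr fun m _ => hclass m
  -- the class sum as a lattice sum of `gd`
  have hsumC : ((∑ m ∈ Icc 1 (X / d) with ((m : ℕ) : ZMod q) = c, α (d * m) : ℝ) : ℂ) =
      ∑' k : ℤ, gd (r + (q : ℝ) * k) := by
    rw [← sum_filter_intModEq_eq_tsum hq r hgd₁ hgd₂, ← hfilter]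
    push_cast
    refine Finset.sum_congr rfl fun m hm => ?_
    have hm' := (Finset.mem_filter.mp hm).1
    rw [Finset.mem_Icc] at hm'
    have hdm : d * m ∈ Icc 1 X := by
      rw [Finset.mem_Icc]
      refine ⟨Nat.mul_pos hd hm'.1, ?_⟩
      have := (Nat.le_div_iff_mul_le hd).mp hm'.2
      rwa [mul_comm] at this
    rw [hα _ hdm, hgd]
    push_cast
    ring_nf
  -- Poisson summation for `gd`
  have hmain := Literature.Barriers.Parity.TaoTeravainen.norm_tsum_sub_div_integral_le hgd_diff
    hgd_supp (m := 2) le_rfl (L := (q : ℝ)) (by exact_mod_cast hq) (r : ℝ)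
  -- `∫ gd = d⁻¹ ∫ g` and `∫ ‖gd''‖ = d ∫ ‖g''‖`
  have hint : ∫ y, gd y = (d : ℝ)⁻¹ • ∫ y, g y := by
    rw [hgd, MeasureTheory.Measure.integral_comp_mul_left g d, abs_of_nonneg (by positivity)]
  have hderiv : iteratedDeriv 2 gd = fun y => ((d : ℝ) ^ 2) • iteratedDeriv 2 g (d * y) := by
    rw [hgd]
    exact iteratedDeriv_comp_const_smul (hg.of_le (WithTop.coe_le_coe.mpr le_top)) (d : ℝ)
  have hint2 : ∫ y, ‖iteratedDeriv 2 gd y‖ = d * ∫ y, ‖iteratedDeriv 2 g y‖ := by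
    rw [hderiv]
    simp only [norm_smul, Real.norm_eq_abs, abs_pow, Nat.abs_cast]
    rw [MeasureTheory.integral_const_mul,
      MeasureTheory.Measure.integral_comp_mul_left (fun y => ‖iteratedDeriv 2 g y‖) d,
      abs_of_nonneg (by positivity), smul_eq_mul]
    field_simp
  have hconst : (Real.pi ^ 2 / 3) / (2 * Real.pi) ^ 2 * (q : ℝ) ^ (2 - 1) *
      (d * ∫ y, ‖iteratedDeriv 2 g y‖) = (q : ℝ) * d / 12 * ∫ y, ‖iteratedDeriv 2 g y‖ := by
    have hπ : Real.pi ≠ 0 := Real.pi_ne_zero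
    field_simp
    ring
  rw [hint2, hconst, hint] at hmain
  -- take real parts
  have hI : (((q : ℝ)⁻¹ : ℝ) : ℂ) * ((d : ℝ)⁻¹ • ∫ y, g y) =
      ((((q : ℝ) * d)⁻¹ : ℝ) : ℂ) * ∫ y, g y := by
    rw [Complex.real_smul, ← mul_assoc, ← Complex.ofReal_mul, mul_inv]
  have hre : ∑ m ∈ Icc 1 (X / d) with ((m : ℕ) : ZMod q) = c, α (d * m) -
      (∫ y, g y).re / ((q : ℝ) * d) =
      ((∑' k : ℤ, gd (r + (q : ℝ) * k)) - (((q : ℝ)⁻¹ : ℝ) : ℂ) * ((d : ℝ)⁻¹ • ∫ y, g y)).re := by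
    rw [Complex.sub_re, ← hsumC, Complex.ofReal_re, hI, Complex.re_ofReal_mul, div_eq_inv_mul]
  rw [hre]
  exact (Complex.abs_re_le_norm _).trans hmain

end Poisson

section SmoothSiegelWalfisz

/-- **The Siegel–Walfisz property of a smooth sequence, with the coprimality restriction**
(Polymath 8a, Lemma 3.4 (iii), the case `k > j`: "`α_k` is smooth, and the Siegel–Walfisz property
for `α_k` follows from the Poisson summation formula (and the rapid decay of the Fourier transform of
smooth, compactly supported functions)"; Definition 2.5 (ii) asks for
`|Δ(α 1_{(·,r)=1}; a (q))| ≪ τ(qr)^{O(1)} N log^{-A} x` for all `q, r ≥ 1`).  Explicit form proved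
here: if `g ∈ C_c^∞(ℝ)` vanishes outside `(1/2, X + 1/2)` and `α = g` on `[1, X]`, then for `q, r ≥ 1`
and every primitive `a (q)`,
`|Δ(α 1_{(·,r)=1}; a (q))| ≤ (q/6) ∫|g''| · ∑_{d ∣ r, d ≤ X} d`
— Möbius inversion of `1_{(n,r)=1}` (`sum_filter_coprime_eq_sum_divisors_moebius`), Poisson
summation along the multiples of each `d ∣ r` coprime to `q` (`abs_classSum_multiples_sub_le`; the
`d` not coprime to `q` meet no primitive class, the `d > X` no `n ≤ X`), and cancellation of the
`a`-independent main term `∑_{d} μ(d) Re ∫g/(qd)` in the discrepancy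
(`abs_apDiscrepancy_le_of_unit_classSum`).  With `g = ψ_N`, `∫|g''| ≪ N^{-1} log^{O(1)} x`,
`X ≍ N` and `∑_{d ∣ r, d ≤ X} d ≤ X τ(r)`, this is `≪ q τ(r) log^{O(1)} x`, which is
`≪ τ(qr) N log^{-A} x` in the range `q ≤ N log^{-A-O(1)} x` (larger `q` are handled by the trivial
bound `abs_apDiscrepancy_le`). [cite: Polymath8a2014, Lemma 3.4 (iii) (proof, smooth case) with Definition 2.5 (ii)] -/
theorem abs_apDiscrepancy_coprime_smooth_le {g : ℝ → ℂ} (hg : ContDiff ℝ ∞ g)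
    (hs : HasCompactSupport g) {X : ℕ} (hg₁ : ∀ y : ℝ, y ≤ 1 / 2 → g y = 0)
    (hg₂ : ∀ y : ℝ, (X : ℝ) + 1 / 2 ≤ y → g y = 0) {α : ℕ → ℝ} (hα : ∀ n ∈ Icc 1 X, (α n : ℂ) = g n)
    {q : ℕ} [NeZero q] {r : ℕ} (hr : r ≠ 0) (a : (ZMod q)ˣ) :
    |apDiscrepancy (fun n => if Nat.Coprime n r then α n else 0) X q a| ≤
      (q : ℝ) / 6 * (∫ y, ‖iteratedDeriv 2 g y‖) * ∑ d ∈ r.divisors with d ≤ X, (d : ℝ) := by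
  classical
  have hq : 0 < q := NeZero.pos q
  set I₂ : ℝ := ∫ y, ‖iteratedDeriv 2 g y‖ with hI₂
  have hI₂0 : 0 ≤ I₂ := MeasureTheory.integral_nonneg fun _ => norm_nonneg _
  -- the common main term and the error
  set mt : ℕ → ℝ := fun d =>
    if IsUnit ((d : ℕ) : ZMod q) then (μ d : ℝ) * ((∫ y, g y).re / ((q : ℝ) * d)) else 0 with hmt
  set m : ℝ := ∑ d ∈ r.divisors with d ≤ X, mt d with hm
  set E : ℝ := (q : ℝ) / 12 * I₂ * ∑ d ∈ r.divisors with d ≤ X, (d : ℝ) with hE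
  have h2E : (q : ℝ) / 6 * I₂ * ∑ d ∈ r.divisors with d ≤ X, (d : ℝ) = 2 * E := by
    rw [hE]; ring
  rw [h2E]
  refine abs_apDiscrepancy_le_of_unit_classSum _ X (m := m) (E := E) (fun u => ?_) a
  -- the class sum of `α 1_{(·,r)=1}` over `u`, by Möbius inversion and multiples
  let J : ℕ → ℝ := fun d => ∑ mm ∈ (Icc 1 (X / d)).filter
    (fun mm : ℕ => ((d * mm : ℕ) : ZMod q) = u), α (d * mm)
  have hJd : ∀ d, J d = ∑ mm ∈ (Icc 1 (X / d)).filter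
      (fun mm : ℕ => ((d * mm : ℕ) : ZMod q) = u), α (d * mm) := fun d => rfl
  have hS : ∑ n ∈ Icc 1 X with ((n : ℕ) : ZMod q) = u, (if Nat.Coprime n r then α n else 0) =
      ∑ d ∈ r.divisors, (μ d : ℝ) * J d := by
    rw [← Finset.sum_filter, sum_filter_coprime_eq_sum_divisors_moebius _ _ hr]
    refine Finset.sum_congr rfl fun d hd => ?_
    rw [hJd, sum_filter_dvd_eq_sum_div _ _ _ (Nat.pos_of_mem_divisors hd)]
  -- align the main term as a sum over all divisors
  have hm' : m = ∑ d ∈ r.divisors, if d ≤ X then mt d else 0 := by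
    rw [hm, Finset.sum_filter]
  rw [hS, hm', ← Finset.sum_sub_distrib]
  -- termwise bound
  have hterm : ∀ d ∈ r.divisors, |(μ d : ℝ) * J d - (if d ≤ X then mt d else 0)| ≤
      if d ≤ X then (q : ℝ) * d / 12 * I₂ else 0 := by
    intro d hd
    have hd0 : 0 < d := Nat.pos_of_mem_divisors hd
    by_cases hdX : d ≤ X
    · rw [if_pos hdX, if_pos hdX]
      by_cases hu : IsUnit ((d : ℕ) : ZMod q)
      · -- Poisson along the multiples of `d`, in the class `d⁻¹ u`
        have hmt' : mt d = (μ d : ℝ) * ((∫ y, g y).re / ((q : ℝ) * d)) := by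
          simp only [hmt, if_pos hu]
        obtain ⟨ud, hud⟩ := id hu
        have hJ' : J d = ∑ mm ∈ (Icc 1 (X / d)).filter
            (fun mm : ℕ => ((mm : ℕ) : ZMod q) = ((ud⁻¹ : (ZMod q)ˣ) : ZMod q) * u), α (d * mm) := by
          rw [hJd]
          exact Finset.sum_congr (Finset.filter_congr fun mm _ =>
            natCast_mul_eq_iff_of_isUnit ud hud _ mm) fun _ _ => rfl
        have hP := abs_classSum_multiples_sub_le hg hs hg₁ hg₂ hα hd0 hq
          (((ud⁻¹ : (ZMod q)ˣ) : ZMod q) * u)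
        rw [← hJ'] at hP
        rw [hmt', ← mul_sub, abs_mul]
        have hμ : |(μ d : ℝ)| ≤ 1 := by exact_mod_cast ArithmeticFunction.abs_moebius_le_one
        calc |(μ d : ℝ)| * |J d - (∫ y, g y).re / ((q : ℝ) * d)|
            ≤ 1 * ((q : ℝ) * d / 12 * I₂) :=
              mul_le_mul hμ hP (abs_nonneg _) zero_le_one
          _ = (q : ℝ) * d / 12 * I₂ := one_mul _
      · -- no multiple of `d` lies in a primitive class
        have hmt' : mt d = 0 := by simp only [hmt, if_neg hu]
        have hJ0 : J d = 0 := by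
          rw [hJd]
          refine Finset.sum_eq_zero fun mm hmm => ?_
          exact absurd (Finset.mem_filter.mp hmm).2 (natCast_mul_ne_of_not_isUnit hu u mm)
        rw [hmt', hJ0, mul_zero, sub_zero, abs_zero]
        positivity
    · -- `d > X`: no `n ≤ X` is a multiple of `d`
      rw [if_neg hdX, if_neg hdX, sub_zero]
      have hJ0 : J d = 0 := by
        rw [hJd, Nat.div_eq_of_lt (not_le.mp hdX)]
        simp
      rw [hJ0, mul_zero, abs_zero]
  refine (Finset.abs_sum_le_sum_abs _ _).trans ((Finset.sum_le_sum hterm).trans (le_of_eq ?_))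
  rw [hE, ← Finset.sum_filter, Finset.mul_sum]
  refine Finset.sum_congr rfl fun d _ => ?_
  ring

/-- `∑_{d ∣ r, d ≤ X} d ≤ X τ(r)` (each of the at most `τ(r)` terms is `≤ X`), the form in which the
previous bound is `≪ q X τ(r) ∫|g''|`. [folklore] -/
theorem sum_divisors_filter_le_mul_card (r X : ℕ) :
    ∑ d ∈ r.divisors with d ≤ X, (d : ℝ) ≤ X * (r.divisors.card : ℝ) := by
  calc ∑ d ∈ r.divisors with d ≤ X, (d : ℝ) ≤ ∑ d ∈ r.divisors with d ≤ X, (X : ℝ) :=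
        Finset.sum_le_sum fun d hd => by exact_mod_cast (Finset.mem_filter.mp hd).2
    _ = ((r.divisors.filter (· ≤ X)).card : ℝ) * X := by rw [Finset.sum_const, nsmul_eq_mul]
    _ ≤ (r.divisors.card : ℝ) * X := by
        gcongr
        exact Finset.filter_subset _ _
    _ = X * (r.divisors.card : ℝ) := mul_comm _ _

end SmoothSiegelWalfisz

end Polymath8a

end Literature.NumberTheory.Sieve
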